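import Summits.ABC.IUTFork.Thm311RealInd1StripPacketStrictnessDyadicTraceClass
import Summits.ABC.IUTFork.Thm311RealInd1StripGlobalStrictnessDyadic
import HarnessLib

/-!
# [IUTchIII] Thm 3.11 (i) (Ind1)+(Ind2) ⟶ Cor 3.12 at the prime `2`, reading (P): `ln ν̄_{𝕃_2}` over ANY TRACE-SCALING `H ≤ indTwo` is STRICTLY below
# the Dupuy–Hilado container's `−|log(Θ)|^{(P)}_2`, and the GLOBAL nonarchimedean Θ-side over `H` is strictly below `−|log(Θ)|^{(P),nonarch}`
# (the prime / input / global re-threading of (ψ5″) = C-R232 §4; UNCONDITIONAL; no room condition, no Jannsen–Wingberg / Diekert–Nishio binder)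

PROOF-ONLY file (abc-iut cell; seat abc-iut-2r-A «two-readings A»; the «second file» named in row R40 «C:PSI5-TRACE-CLASS» (ψ5″) — C-R232 §4's
prime/input re-threading, which the packet file `Thm311RealInd1StripPacketStrictnessDyadicTraceClass` (★ p643111) deferred).  It ports, with the
factorwise hypothesis `hHfac` REPLACED by the intrinsic trace-scaling hypothesis `hHtr` («every member of `H` at the one collection scales `Tr_{X/ℚ₂}` by a
`2`-adic integer»), abc-iut-c312-1 gen 27's file 3/3 `Thm311RealInd1StripPrimeStrictnessDyadic` (prime level, reading (P)) and the reading-(P) half of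
gen 27's file 5 `Thm311RealInd1StripGlobalStrictnessDyadic` (input level and global); proofs verbatim, the two packet-level call sites redirected to
`packetHull_orbitH_ne_container_of_dyadicSqrtNegOne_of_traceScaling` / `packetLogμ_packetHull_orbitH_le_container_sub_of_dyadicSqrtNegOne_of_traceScaling`.
Those files' bytes, (ψ5) ★ p606976, R35, R38/R38b/R39/R39c are UNTOUCHED.  TAKES NO SIDE on [IUTchIII] Cor. 3.12.  No definition, no `Prop` fact, no
instance, no notation, no attribute.

SETTING (as file 3/3 / file 5).  Prime level: the real prime packet `realPrimePacketWith 2 (σ.localFields 2) c` over the GENUINE completions of a place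
section `σ` (any shell normalisation `c`), `K ∋ s` with `s² = −1`, every place of the section over `2` of local degree `2` (`K_{v̲} ≅ ℚ₂(√−1)`), a `2`-local
Θ-idele `t` (ANY), a family `H = (H_{j,v⃗})` of subgroups of the container `indTwo`, and at ONE degree `j₁ = i₁+1` and ONE collection `v⃗₁ = e₁` the
TRACE-SCALING hypothesis `hHtr`.  Input / global level: a genuine Θ-volume input `I : ThetaVolumeInput F₀ K` (`2 ∈ T(I)`), its sharp Θ-idele `I.tΘ`, a
PRIME-INDEXED family `H ≤ indTwo`, `hHtr` for `H_{2,j₁,v⃗₁}`.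
* §1 PRIME LEVEL: **`localFields_packetHull_orbitH_pilotRegion_ne_slotImagesHull_of_dyadicSqrtNegOne_of_traceScaling`** (the orbit hull of `O_𝕃(−P_Θ)_{v⃗}` is NOT
  the slot-image hull), **`localFields_lnνLp_hull_orbitH_le_negLogThetaPerImageAt_sub_of_dyadicSqrtNegOne_of_traceScaling`** (`ln ν̄_{𝕃_2}(reading (P) over H) ≤
  −|log(Θ)|^{(P)}_2 − (1/ℓ⋆)·((Σ_j f(L_j)/D)·log 2)·Π_b Pr(v_{1,b})`) and **`…_lt_negLogThetaPerImageAt_of_dyadicSqrtNegOne_of_traceScaling`** (`<`, `ℓ⋆ ≥ 1`).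
* §2 INPUT LEVEL: **`ThetaVolumeInput.lnνLp_hull_orbitH_lt_negLogThetaPerImageLoc_two_of_dyadicSqrtNegOne_of_traceScaling`** (`< negLogThetaPerImageLoc I 2`).
* §3 GLOBAL: **`ThetaVolumeInput.sum_lnνLp_hull_orbitH_lt_negLogThetaPerImageNonarch_of_dyadicSqrtNegOne_of_traceScaling`** and **`…_ne_…_of_traceScaling`** — the
  nonarchimedean Θ-side over `H` in reading (P) is STRICTLY below `−|log(Θ)|^{(P),nonarch}` (the `2`-summand strictly, §2; every other summand `≤`, R31 §1), so
  R32 §1's global identity FAILS AS TYPED for every such input and every trace-scaling `H`.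
NOT HERE: the reading-(U) twins (gen 27's file 4 `Thm311RealInd1StripPrimeStrictnessDyadicUnion` has its own packet-level union theorem consuming `hHfac`;
its trace-class port is a further file, not commissioned); the (ψ5″) calibration against R39c (C-R232 §5).
READING (numbers about OUR typed objects; neutral): for inputs over a field `K ∋ √−1` all of whose section places over `2` have local degree `2`, the
`p = 2` summand of the Θ-side of [IUTchIII] Cor. 3.12 in reading (P), computed over ANY `H ≤ indTwo` that is trace-scaling at one dyadic collection, is
STRICTLY below Dupuy–Hilado's `−|log(Θ)|^{(P)}_2`, and the global identity «Θ-side over `H` = `−|log(Θ)|^{(P),nonarch}`» FAILS AS TYPED — the (ψ5) rows of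
record with «factorwise-strip» weakened to «trace-scaling».  HONEST SCOPE: OUR typings (THE equivariant lift, THE logarithm, OUR `indTwo`, OUR `(R_I)^∼`-hull;
F-B28-1 untouched); equal-AS-TYPED ≠ equal in print; located ≠ adjudicated; nothing about print's indeterminacies beyond the typed (Ind1)⊔(Ind2), nothing about
NON-trace-scaling members of `indTwo`; calibrates `stub_cor312PerImage` at the `p = 2` residual and DISCHARGES NOTHING on it / on `ThetaPartII` (RESHAPE-4
untouched; (β2)/(α2)/(γ2) HELD); no side taken on [IUTchIII] Cor. 3.12 / Thm. 3.11 / [IUTchIV] Thm. 1.10, on (U) vs (P), or on any author; IUT is DISPUTED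
in print (`Literature/Barriers/ABC/IUTDisputedClaim.lean`); nothing here asserts that abc or Szpiro is proved or refuted. [claim: Mochizuki2012, status:
disputed]; [cite: Mochizuki2012, IUTchI Def. 3.1 (a)(e) pp. 61–62; IUTchIII Thm. 3.11 (i) (Ind1)(Ind2) p. 154; Cor. 3.12 pp. 173–174, proof Step (x) p. 181,
Step (xi) p. 183; IUTchIV Thm. 1.10 Step (vi) p. 29, Prop. 1.4 (iii) p. 13]; [cite: DupuyHilado2025, §1 (1.1), Def. 3.6.1, Def. 3.6.3, §3.9, §4.9, §4.12];
[cite: NeukirchANT1999, Ch. II Prop. (5.7), (6.8)]. typed ≠ proved; calibrated ≠ discharged.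
-/

set_option autoImplicit false

noncomputable section

open Metric Set Function Module Bornology
open scoped Pointwise TensorProduct

namespace Summit.ABC.IUTFork.Thm311.Real

open NumberField IsDedekindDomain Literature.NumberTheory.NumberFields Literature.IUT.LogVolume
open Literature.NumberTheory.GaloisRepresentations Literature.NumberTheory.GaloisRepresentations.Ultrametric
open Literature.AnabelianGeometry.AbsoluteAnabelian Literature.IUT.HodgeArakelov
open Literature.IUT.HodgeArakelov.AbsTopMonoids Literature.IUT.LogThetaLattice
open Literature.IUT.LogVolume.TraceZeroDyadicSqrtNegOne

/-! ## §1 PRIME LEVEL: the genuine place-section packets at `p = 2`, reading (P) over a trace-scaling `H` is STRICTLY below `−|log(Θ)|^{(P)}_2` -/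

section PlaceSection

variable {F₀ : Type} [Field F₀] [NumberField F₀] {K : Type} [Field K] [NumberField K] [Algebra F₀ K]
variable (σ : PlaceSection F₀ K)
variable (c : (j : ℕ) → (Fin (j + 1) → placesOver F₀ 2) → ℚ_[2]) (hc0 : ∀ j e, c j e ≠ 0)
  (hcσ : ∀ (j : ℕ) (τ : Equiv.Perm (Fin (j + 1))) (e : Fin (j + 1) → placesOver F₀ 2), c j (e ∘ τ) = c j e)

/-- **AT EVERY ALL-`ℚ₂(√−1)` COLLECTION THE ORBIT HULL OF THE Θ-REGION UNDER A TRACE-SCALING `H` IS NOT THE SLOT-IMAGE HULL** (UNCONDITIONAL).  Real prime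
packet over the genuine completions of a place section (any shell `c`), `K ∋ s` with `s² = −1`, every place of the section over `2` of local degree `2`;
Θ-idele `t`, degree `j = i+1`, collection `v⃗ = e`; `H ≤ indTwo` whose every member scales `Tr_{X/ℚ₂}` by a `2`-adic integer.  Then
`packetHull(⋃_{g∈H} g(O_𝕃(−P_Θ)_{v⃗})) ≠ slotImagesHull(O_𝕃(−P_Θ))_{v⃗}` (packet file §2 at the content of the Θ-region, abc-iut-s2
`realPrimePacketWith_exists_content_logμ_slotImagesHull`).  Gen 27 file 3/3's `…_of_dyadicSqrtNegOne` (`Thm311RealInd1StripPrimeStrictnessDyadic.lean:85`) with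
`hHfac ↦ hHtr`. [claim: Mochizuki2012, status: disputed] [cite: Mochizuki2012, IUTchI Def. 3.1 (a)(e) pp. 61–62; IUTchIII Thm. 3.11 (i) p. 154; Cor. 3.12 proof
Step (x) p. 181, Step (xi) p. 183] [cite: DupuyHilado2025, §3.9, §4.9, §4.12] [cite: NeukirchANT1999, Ch. II Prop. (5.7), (6.8)] -/
theorem localFields_packetHull_orbitH_pilotRegion_ne_slotImagesHull_of_dyadicSqrtNegOne_of_traceScaling {s : K} (hs : s ^ 2 = -1)
    (hd : ∀ w : placesOver F₀ 2, localDeg K (σ.lift w.1) = 2) {lstar : ℕ}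
    (t : Fin lstar → (v : placesOver F₀ 2) → ((σ.localFields 2).k v)ˣ) (i : Fin lstar)
    (e : Fin ((i : ℕ) + 1 + 1) → placesOver F₀ 2)
    (H : Subgroup (PacketAlgebra 2 (fun b => (σ.localFields 2).k (e b)) ≃ₗ[ℚ_[2]]
      PacketAlgebra 2 (fun b => (σ.localFields 2).k (e b))))
    (hH : H ≤ indTwo 2 (fun b => (σ.localFields 2).k (e b)))
    (hHtr : ∀ γ ∈ H, ∃ u : ℚ_[2], ‖u‖ ≤ 1 ∧ ∀ x,
      Algebra.trace ℚ_[2] (PacketAlgebra 2 (fun b => (σ.localFields 2).k (e b))) (γ x) =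
        u * Algebra.trace ℚ_[2] (PacketAlgebra 2 (fun b => (σ.localFields 2).k (e b))) x) :
    packetHull 2 (fun b => (σ.localFields 2).k (e b))
        (⋃ γ : H, (γ : PacketAlgebra 2 (fun b => (σ.localFields 2).k (e b)) ≃ₗ[ℚ_[2]]
            PacketAlgebra 2 (fun b => (σ.localFields 2).k (e b))) ''
          (realPrimePacketWith 2 (σ.localFields 2) c hc0 hcσ).pilotRegion t ((i : ℕ) + 1) e) ≠
      (realPrimePacketWith 2 (σ.localFields 2) c hc0 hcσ).slotImagesHull
        ((realPrimePacketWith 2 (σ.localFields 2) c hc0 hcσ).pilotRegion t) ((i : ℕ) + 1) e := by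
  -- the per-factor data of the dyadic shape
  have hι : ∀ b, (RescaledCompletion.of K 2 (σ.lift (e b).1) (σ.natCast_mem_lift (e b))
      (algebraMap K ((σ.lift (e b).1).adicCompletion K) s)) ^ 2 = -1 :=
    fun b => sq_of_algebraMap_eq_neg_one' (σ.lift (e b).1) (σ.natCast_mem_lift (e b)) hs
  have hef := fun b => absRamificationIdx_eq_two_and_residueDegree_eq_one_of_localDeg_eq_two (σ.lift (e b).1)
    (σ.natCast_mem_lift (e b)) (hι b) (hd (e b))
  have hϖex := fun b => exists_isUniformizer (F := (σ.localFields 2).k (e b))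
  choose ϖ hϖ using hϖex
  obtain ⟨m, hm, -, hhull, -, -⟩ := realPrimePacketWith_exists_content_logμ_slotImagesHull 2 (σ.localFields 2) c hc0 hcσ t i e
  rw [hhull, realPrimePacketWith_pilotRegion_succ_eq]
  exact packetHull_orbitH_ne_container_of_dyadicSqrtNegOne_of_traceScaling (fun b => σ.lift (e b).1)
    (fun b => σ.natCast_mem_lift (e b)) hι (fun b => (hef b).1) (fun b => (hef b).2) hϖ (Fin.last_pos.ne) H hH hHtr
    (zpow_ne_zero m (by norm_num)) hm

/-- **READING (P) AT `p = 2` OVER A TRACE-SCALING `H`: STRICTLY BELOW `−|log(Θ)|^{(P)}_2` BY AN EXPLICIT MARGIN (UNCONDITIONAL, NO ROOM CONDITION).**  Real prime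
packet over the genuine completions of a place section (any shell `c`), `K ∋ s` with `s² = −1`, every place of the section over `2` of local degree `2`,
Θ-idele `t`, family `H = (H_{j,v⃗})` of subgroups of the container `indTwo`; if at ONE degree `j₁ = i₁+1 ≤ ℓ⋆` and ONE collection `v⃗₁ = e₁` every member of
`H_{j₁,v⃗₁}` scales `Tr_{X/ℚ₂}` by a `2`-adic integer, then
`ln ν̄_{𝕃_2}(v⃗ ↦ hull(⋃_{g∈H_{v⃗}} g(O_𝕃(−P_Θ)_{v⃗}))) ≤ −|log(Θ)|^{(P)}_2 − (1/ℓ⋆)·((Σ_j f(L_j)/D)·log 2)·Π_b Pr(v_{1,b})` (packet file §2 at the content of the Θ-region +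
gen 21 `lnνLp_le_sub_of_succ`).  Gen 27 file 3/3's `…_of_dyadicSqrtNegOne` (`:127`) with `hHfac ↦ hHtr`. [claim: Mochizuki2012, status: disputed]
[cite: Mochizuki2012, IUTchI Def. 3.1 (a)(e) pp. 61–62; IUTchIII Thm. 3.11 (i) p. 154; Cor. 3.12 proof Step (x) p. 181; IUTchIV Prop. 1.4 (iii) p. 13]
[cite: DupuyHilado2025, Def. 3.6.3, §3.9, §4.9, §4.12] [cite: NeukirchANT1999, Ch. II Prop. (5.7), (6.8)] -/
theorem localFields_lnνLp_hull_orbitH_le_negLogThetaPerImageAt_sub_of_dyadicSqrtNegOne_of_traceScaling {s : K} (hs : s ^ 2 = -1)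
    (hd : ∀ w : placesOver F₀ 2, localDeg K (σ.lift w.1) = 2) {lstar : ℕ}
    (t : Fin lstar → (v : placesOver F₀ 2) → ((σ.localFields 2).k v)ˣ)
    (H : (j : ℕ) → (e : Fin (j + 1) → placesOver F₀ 2) →
      Subgroup (PacketAlgebra 2 (fun b => (σ.localFields 2).k (e b)) ≃ₗ[ℚ_[2]]
        PacketAlgebra 2 (fun b => (σ.localFields 2).k (e b))))
    (hH : ∀ j e, H j e ≤ indTwo 2 (fun b => (σ.localFields 2).k (e b)))
    (i₁ : Fin lstar) (e₁ : Fin ((i₁ : ℕ) + 1 + 1) → placesOver F₀ 2)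
    (hHtr : ∀ γ ∈ H ((i₁ : ℕ) + 1) e₁, ∃ u : ℚ_[2], ‖u‖ ≤ 1 ∧ ∀ x,
      Algebra.trace ℚ_[2] (PacketAlgebra 2 (fun b => (σ.localFields 2).k (e₁ b))) (γ x) =
        u * Algebra.trace ℚ_[2] (PacketAlgebra 2 (fun b => (σ.localFields 2).k (e₁ b))) x) :
    (realPrimePacketWith 2 (σ.localFields 2) c hc0 hcσ).lnνLp lstar (fun j e =>
        packetHull 2 (fun b => (σ.localFields 2).k (e b))
          (⋃ g : H j e, (g : PacketAlgebra 2 (fun b => (σ.localFields 2).k (e b)) ≃ₗ[ℚ_[2]]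
              PacketAlgebra 2 (fun b => (σ.localFields 2).k (e b))) ''
            (realPrimePacketWith 2 (σ.localFields 2) c hc0 hcσ).pilotRegion t j e)) ≤
      (realPrimePacketWith 2 (σ.localFields 2) c hc0 hcσ).negLogThetaPerImageAt lstar t -
        (1 / (lstar : ℝ)) *
          (((∑ j, (residueDegree 2 (DFac 2 (fun b => (σ.localFields 2).k (e₁ b)) j) : ℝ)) /
              packetDegree 2 (DFac 2 (fun b => (σ.localFields 2).k (e₁ b))) * Real.log 2) *
            ∏ b, weight F₀ (e₁ b).1) := by
  unfold PrimePacket.negLogThetaPerImageAt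
  refine lnνLp_le_sub_of_succ (realPrimePacketWith 2 (σ.localFields 2) c hc0 hcσ) lstar (fun i e => ⟨?_, ?_, ?_⟩) i₁ e₁ ?_
  · exact realPrimePacketWith_packetAdm_hull_orbitH 2 (σ.localFields 2) c hc0 hcσ t i e (H _ e) (hH _ e)
  · obtain ⟨m, -, -, -, hadm, -⟩ := realPrimePacketWith_exists_content_logμ_slotImagesHull 2 (σ.localFields 2) c hc0 hcσ t i e
    exact hadm
  · exact packetHull_mono 2 _ (realPrimePacketWith_orbitH_subset_slotImages 2 (σ.localFields 2) c hc0 hcσ t i e (H _ e) (hH _ e))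
  · -- the special summand: packet file §2 at `v⃗₁`, read against the content identity for the container's summand
    have hι : ∀ b, (RescaledCompletion.of K 2 (σ.lift (e₁ b).1) (σ.natCast_mem_lift (e₁ b))
        (algebraMap K ((σ.lift (e₁ b).1).adicCompletion K) s)) ^ 2 = -1 :=
      fun b => sq_of_algebraMap_eq_neg_one' (σ.lift (e₁ b).1) (σ.natCast_mem_lift (e₁ b)) hs
    have hef := fun b => absRamificationIdx_eq_two_and_residueDegree_eq_one_of_localDeg_eq_two (σ.lift (e₁ b).1)
      (σ.natCast_mem_lift (e₁ b)) (hι b) (hd (e₁ b))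
    have hϖex := fun b => exists_isUniformizer (F := (σ.localFields 2).k (e₁ b))
    choose ϖ hϖ using hϖex
    show packetLogμ 2 (fun b => (σ.localFields 2).k (e₁ b)) _ ≤
      packetLogμ 2 (fun b => (σ.localFields 2).k (e₁ b))
        ((realPrimePacketWith 2 (σ.localFields 2) c hc0 hcσ).slotImagesHull
          ((realPrimePacketWith 2 (σ.localFields 2) c hc0 hcσ).pilotRegion t) ((i₁ : ℕ) + 1) e₁) - _
    obtain ⟨m, hm, -, hhull, -, -⟩ := realPrimePacketWith_exists_content_logμ_slotImagesHull 2 (σ.localFields 2) c hc0 hcσ t i₁ e₁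
    rw [hhull, realPrimePacketWith_pilotRegion_succ_eq]
    exact (packetLogμ_packetHull_orbitH_le_container_sub_of_dyadicSqrtNegOne_of_traceScaling (fun b => σ.lift (e₁ b).1)
      (fun b => σ.natCast_mem_lift (e₁ b)) hι (fun b => (hef b).1) (fun b => (hef b).2) hϖ (Fin.last_pos.ne) (Fin.last _)
      (t i₁ (e₁ (Fin.last _))).ne_zero hm (H _ e₁) (hH _ e₁) hHtr).2

/-- **Hence STRICTLY below `−|log(Θ)|^{(P)}_2`** (every `Pr(v) > 0`, `ℓ⋆ ≥ 1`, margin `(Σ_j f_j/D)·log 2 > 0`): under the hypotheses of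
`…_le_negLogThetaPerImageAt_sub_of_dyadicSqrtNegOne_of_traceScaling`, `ln ν̄_{𝕃_2}(reading (P) over H) < −|log(Θ)|^{(P)}_2` — for EVERY Θ-idele `t`.  Gen 27 file 3/3's
`…_lt_…_of_dyadicSqrtNegOne` (`:182`) with `hHfac ↦ hHtr`. [claim: Mochizuki2012, status: disputed]
[cite: Mochizuki2012, IUTchIII Thm. 3.11 (i) p. 154; Cor. 3.12 p. 174, proof Step (x) p. 181] [cite: DupuyHilado2025, Def. 3.6.3, §4.9, §4.12] -/
theorem localFields_lnνLp_hull_orbitH_lt_negLogThetaPerImageAt_of_dyadicSqrtNegOne_of_traceScaling {s : K} (hs : s ^ 2 = -1)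
    (hd : ∀ w : placesOver F₀ 2, localDeg K (σ.lift w.1) = 2) {lstar : ℕ}
    (t : Fin lstar → (v : placesOver F₀ 2) → ((σ.localFields 2).k v)ˣ)
    (H : (j : ℕ) → (e : Fin (j + 1) → placesOver F₀ 2) →
      Subgroup (PacketAlgebra 2 (fun b => (σ.localFields 2).k (e b)) ≃ₗ[ℚ_[2]]
        PacketAlgebra 2 (fun b => (σ.localFields 2).k (e b))))
    (hH : ∀ j e, H j e ≤ indTwo 2 (fun b => (σ.localFields 2).k (e b)))
    (i₁ : Fin lstar) (e₁ : Fin ((i₁ : ℕ) + 1 + 1) → placesOver F₀ 2)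
    (hHtr : ∀ γ ∈ H ((i₁ : ℕ) + 1) e₁, ∃ u : ℚ_[2], ‖u‖ ≤ 1 ∧ ∀ x,
      Algebra.trace ℚ_[2] (PacketAlgebra 2 (fun b => (σ.localFields 2).k (e₁ b))) (γ x) =
        u * Algebra.trace ℚ_[2] (PacketAlgebra 2 (fun b => (σ.localFields 2).k (e₁ b))) x) :
    (realPrimePacketWith 2 (σ.localFields 2) c hc0 hcσ).lnνLp lstar (fun j e =>
        packetHull 2 (fun b => (σ.localFields 2).k (e b))
          (⋃ g : H j e, (g : PacketAlgebra 2 (fun b => (σ.localFields 2).k (e b)) ≃ₗ[ℚ_[2]]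
              PacketAlgebra 2 (fun b => (σ.localFields 2).k (e b))) ''
            (realPrimePacketWith 2 (σ.localFields 2) c hc0 hcσ).pilotRegion t j e)) <
      (realPrimePacketWith 2 (σ.localFields 2) c hc0 hcσ).negLogThetaPerImageAt lstar t := by
  have hle := localFields_lnνLp_hull_orbitH_le_negLogThetaPerImageAt_sub_of_dyadicSqrtNegOne_of_traceScaling σ c hc0 hcσ hs hd t H hH
    i₁ e₁ hHtr
  haveI : Nonempty (Fin ((i₁ : ℕ) + 1 + 1)) := ⟨Fin.last _⟩
  have hmar := margin_pos 2 (fun b => (σ.localFields 2).k (e₁ b))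
  have hl : (0 : ℝ) < 1 / (lstar : ℝ) := by
    have : 0 < lstar := lt_of_le_of_lt (Nat.zero_le _) i₁.2
    positivity
  have hw : 0 < ∏ b, weight F₀ (e₁ b).1 := by
    refine Finset.prod_pos fun b _ => ?_
    unfold weight
    have h1 : (0 : ℝ) < localDegree F₀ (e₁ b).1 := by exact_mod_cast localDegree_pos F₀ (e₁ b).1
    have h2 : (0 : ℝ) < Module.finrank ℚ F₀ := by exact_mod_cast Module.finrank_pos
    exact div_pos h1 h2
  have hpos : 0 < (1 / (lstar : ℝ)) *
      (((∑ j, (residueDegree 2 (DFac 2 (fun b => (σ.localFields 2).k (e₁ b)) j) : ℝ)) /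
          packetDegree 2 (DFac 2 (fun b => (σ.localFields 2).k (e₁ b))) * Real.log 2) *
        ∏ b, weight F₀ (e₁ b).1) := mul_pos hl (mul_pos hmar hw)
  linarith

end PlaceSection

end Summit.ABC.IUTFork.Thm311.Real

/-! ## §2–§3 INPUT LEVEL AND GLOBAL (reading (P)): the `2`-summand is strictly below `negLogThetaPerImageLoc I 2`; the global identity fails as typed -/

namespace Literature.IUT.LogVolume.ThetaVolumeInput

open Summit.ABC.IUTFork.Thm311.Real Literature.NumberTheory.NumberFields Function
open Literature.NumberTheory.GaloisRepresentations Literature.NumberTheory.GaloisRepresentations.Ultrametric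
open Literature.AnabelianGeometry.AbsoluteAnabelian Literature.IUT.HodgeArakelov
open Literature.IUT.HodgeArakelov.AbsTopMonoids NumberField IsDedekindDomain

variable {F₀ : Type} [Field F₀] [NumberField F₀] {K : Type} [Field K] [NumberField K] [Algebra F₀ K]
variable (I : ThetaVolumeInput F₀ K)

/-- **INPUT LEVEL, reading (P), `p = 2`, TRACE-SCALING `H`: `ln ν̄_{𝕃_2}(reading (P) over H) < negLogThetaPerImageLoc I 2` (UNCONDITIONAL, no room condition)** —
§1's `…_lt_…_of_traceScaling` at `σ := I.σ`, `t := I.tΘ 2`, shell `mScale`; `K ∋ s`, `s² = −1`, every place of the section over `2` of local degree `2`, `H ≤ indTwo`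
trace-scaling at one collection `(i₁, v⃗₁)`.  Gen 27 file 5's `…_of_dyadicSqrtNegOne` (`Thm311RealInd1StripGlobalStrictnessDyadic.lean:66`) with `hHfac ↦ hHtr`.
[claim: Mochizuki2012, status: disputed] [cite: Mochizuki2012, IUTchIII Thm. 3.11 (i) p. 154; Cor. 3.12 proof Step (x) p. 181]
[cite: DupuyHilado2025, Def. 3.6.3, §3.9, §4.9, §4.12] [cite: NeukirchANT1999, Ch. II Prop. (5.7), (6.8)] -/
theorem lnνLp_hull_orbitH_lt_negLogThetaPerImageLoc_two_of_dyadicSqrtNegOne_of_traceScaling {s : K} (hs : s ^ 2 = -1)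
    (hd : ∀ w : placesOver F₀ 2, localDeg K (I.σ.lift w.1) = 2)
    (H : (j : ℕ) → (e : Fin (j + 1) → placesOver F₀ 2) →
      Subgroup (PacketAlgebra 2 (fun b => (I.σ.localFields 2).k (e b)) ≃ₗ[ℚ_[2]]
        PacketAlgebra 2 (fun b => (I.σ.localFields 2).k (e b))))
    (hH : ∀ j e, H j e ≤ indTwo 2 (fun b => (I.σ.localFields 2).k (e b)))
    (i₁ : Fin I.lstar) (e₁ : Fin ((i₁ : ℕ) + 1 + 1) → placesOver F₀ 2)
    (hHtr : ∀ γ ∈ H ((i₁ : ℕ) + 1) e₁, ∃ u : ℚ_[2], ‖u‖ ≤ 1 ∧ ∀ x,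
      Algebra.trace ℚ_[2] (PacketAlgebra 2 (fun b => (I.σ.localFields 2).k (e₁ b))) (γ x) =
        u * Algebra.trace ℚ_[2] (PacketAlgebra 2 (fun b => (I.σ.localFields 2).k (e₁ b))) x) :
    (I.packetAt 2 Nat.prime_two).lnνLp I.lstar (fun j e =>
        packetHull 2 (fun b => (I.σ.localFields 2).k (e b))
          (⋃ g : H j e, (g : PacketAlgebra 2 (fun b => (I.σ.localFields 2).k (e b)) ≃ₗ[ℚ_[2]]
              PacketAlgebra 2 (fun b => (I.σ.localFields 2).k (e b))) ''
            (I.packetAt 2 Nat.prime_two).pilotRegion (I.tΘ 2 Nat.prime_two) j e)) <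
      I.negLogThetaPerImageLoc 2 := by
  rw [negLogThetaPerImageLoc_of_prime I Nat.prime_two]
  exact localFields_lnνLp_hull_orbitH_lt_negLogThetaPerImageAt_of_dyadicSqrtNegOne_of_traceScaling I.σ (mScale 2 (I.σ.localFields 2))
    (mScale_ne_zero 2 (I.σ.localFields 2)) (mScale_perm 2 (I.σ.localFields 2)) hs hd (I.tΘ 2 Nat.prime_two) H hH i₁ e₁ hHtr

/-- **GLOBAL STRICTNESS AT THE DYADIC RESIDUAL OVER A TRACE-SCALING `H`, reading (P) (UNCONDITIONAL).**  For a genuine Θ-volume input over a field `K ∋ s`, `s² = −1`,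
all of whose section places over `2` have local degree `2`, and ANY prime-indexed family `H ≤ indTwo` whose member `H_{2,j₁,v⃗₁}` at ONE collection over `2` is
trace-scaling: the nonarchimedean Θ-side over `H` is STRICTLY below `−|log(Θ)|^{(P),nonarch}` — the `2`-summand (`2 ∈ T(I)`, `two_mem_supportPrimes`) is strictly
smaller (§2), every other summand is `≤` (R31 §1 `lnνLp_hull_orbitH_le_negLogThetaPerImageLoc`).  No hypothesis at any odd prime.  Gen 27 file 5's
`sum_…_lt_…_of_dyadicSqrtNegOne` (`:129`) with `hHfac ↦ hHtr`. [claim: Mochizuki2012, status: disputed] [cite: Mochizuki2012, IUTchIII Thm. 3.11 (i) p. 154;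
Cor. 3.12 pp. 173–174, proof Step (x) p. 181; IUTchIV Thm. 1.10 Step (vi) p. 29] [cite: DupuyHilado2025, §1 (1.1), Def. 3.6.3, §3.9, §4.9, §4.12] -/
theorem sum_lnνLp_hull_orbitH_lt_negLogThetaPerImageNonarch_of_dyadicSqrtNegOne_of_traceScaling {s : K} (hs : s ^ 2 = -1)
    (hd : ∀ w : placesOver F₀ 2, localDeg K (I.σ.lift w.1) = 2)
    (H : ∀ (p : ℕ) (hp : p.Prime), haveI : Fact p.Prime := ⟨hp⟩
      (j : ℕ) → (e : Fin (j + 1) → placesOver F₀ p) →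
        Subgroup (PacketAlgebra p (fun b => (I.σ.localFields p).k (e b)) ≃ₗ[ℚ_[p]]
          PacketAlgebra p (fun b => (I.σ.localFields p).k (e b))))
    (hH : ∀ (p : ℕ) (hp : p.Prime), haveI : Fact p.Prime := ⟨hp⟩; ∀ j e, H p hp j e ≤ indTwo p (fun b => (I.σ.localFields p).k (e b)))
    (i₁ : Fin I.lstar) (e₁ : Fin ((i₁ : ℕ) + 1 + 1) → placesOver F₀ 2)
    (hHtr : ∀ γ ∈ H 2 Nat.prime_two ((i₁ : ℕ) + 1) e₁, ∃ u : ℚ_[2], ‖u‖ ≤ 1 ∧ ∀ x,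
      Algebra.trace ℚ_[2] (PacketAlgebra 2 (fun b => (I.σ.localFields 2).k (e₁ b))) (γ x) =
        u * Algebra.trace ℚ_[2] (PacketAlgebra 2 (fun b => (I.σ.localFields 2).k (e₁ b))) x) :
    (∑ p ∈ I.supportPrimes, if hp : p.Prime then
        (haveI : Fact p.Prime := ⟨hp⟩
        (I.packetAt p hp).lnνLp I.lstar (fun j e =>
          packetHull p (fun b => (I.σ.localFields p).k (e b))
            (⋃ g : H p hp j e, (g : PacketAlgebra p (fun b => (I.σ.localFields p).k (e b)) ≃ₗ[ℚ_[p]]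
                PacketAlgebra p (fun b => (I.σ.localFields p).k (e b))) ''
              (I.packetAt p hp).pilotRegion (I.tΘ p hp) j e))) else 0) <
      I.negLogThetaPerImageNonarch := by
  unfold negLogThetaPerImageNonarch
  refine Finset.sum_lt_sum (fun p hpT => ?_) ⟨2, I.two_mem_supportPrimes, ?_⟩
  · have hp : p.Prime := I.prime_of_mem_supportPrimes hpT
    rw [dif_pos hp]
    exact I.lnνLp_hull_orbitH_le_negLogThetaPerImageLoc hp (H p hp) (hH p hp)
  · rw [dif_pos Nat.prime_two]
    exact I.lnνLp_hull_orbitH_lt_negLogThetaPerImageLoc_two_of_dyadicSqrtNegOne_of_traceScaling hs hd (H 2 Nat.prime_two)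
      (hH 2 Nat.prime_two) i₁ e₁ hHtr

/-- **R32 §1's GLOBAL IDENTITY FAILS AS TYPED over every trace-scaling `H`** (same hypotheses): «Θ-side over `H` = `−|log(Θ)|^{(P),nonarch}`» is FALSE — equivalently the
strict inequality above.  Gen 27 file 5's `sum_…_ne_…_of_dyadicSqrtNegOne` (`:165`) with `hHfac ↦ hHtr`. [claim: Mochizuki2012, status: disputed]
[cite: Mochizuki2012, IUTchIII Cor. 3.12 pp. 173–174, proof Step (x) p. 181; IUTchIV Thm. 1.10 Step (vi) p. 29] [cite: DupuyHilado2025, §1 (1.1), Def. 3.6.3, §4.12] -/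
theorem sum_lnνLp_hull_orbitH_ne_negLogThetaPerImageNonarch_of_dyadicSqrtNegOne_of_traceScaling {s : K} (hs : s ^ 2 = -1)
    (hd : ∀ w : placesOver F₀ 2, localDeg K (I.σ.lift w.1) = 2)
    (H : ∀ (p : ℕ) (hp : p.Prime), haveI : Fact p.Prime := ⟨hp⟩
      (j : ℕ) → (e : Fin (j + 1) → placesOver F₀ p) →
        Subgroup (PacketAlgebra p (fun b => (I.σ.localFields p).k (e b)) ≃ₗ[ℚ_[p]]
          PacketAlgebra p (fun b => (I.σ.localFields p).k (e b))))
    (hH : ∀ (p : ℕ) (hp : p.Prime), haveI : Fact p.Prime := ⟨hp⟩; ∀ j e, H p hp j e ≤ indTwo p (fun b => (I.σ.localFields p).k (e b)))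
    (i₁ : Fin I.lstar) (e₁ : Fin ((i₁ : ℕ) + 1 + 1) → placesOver F₀ 2)
    (hHtr : ∀ γ ∈ H 2 Nat.prime_two ((i₁ : ℕ) + 1) e₁, ∃ u : ℚ_[2], ‖u‖ ≤ 1 ∧ ∀ x,
      Algebra.trace ℚ_[2] (PacketAlgebra 2 (fun b => (I.σ.localFields 2).k (e₁ b))) (γ x) =
        u * Algebra.trace ℚ_[2] (PacketAlgebra 2 (fun b => (I.σ.localFields 2).k (e₁ b))) x) :
    (∑ p ∈ I.supportPrimes, if hp : p.Prime then
        (haveI : Fact p.Prime := ⟨hp⟩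
        (I.packetAt p hp).lnνLp I.lstar (fun j e =>
          packetHull p (fun b => (I.σ.localFields p).k (e b))
            (⋃ g : H p hp j e, (g : PacketAlgebra p (fun b => (I.σ.localFields p).k (e b)) ≃ₗ[ℚ_[p]]
                PacketAlgebra p (fun b => (I.σ.localFields p).k (e b))) ''
              (I.packetAt p hp).pilotRegion (I.tΘ p hp) j e))) else 0) ≠
      I.negLogThetaPerImageNonarch :=
  (I.sum_lnνLp_hull_orbitH_lt_negLogThetaPerImageNonarch_of_dyadicSqrtNegOne_of_traceScaling hs hd H hH i₁ e₁ hHtr).ne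

end Literature.IUT.LogVolume.ThetaVolumeInput

end
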